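import Summits.CriticalPhenomena.PercolationContinuityZ3.Theorems.PercNearOneGluingNoHeavyLowerTailSahiHubCornerChain
import Summits.CriticalPhenomena.PercolationContinuityZ3.Theorems.PercNearOneGluingNoHeavyLowerTailSahiCubePhi
import Mathlib.Tactic.Linarith
import Mathlib.Tactic.Positivity
import HarnessLib

/-!
# `NoHeavyLowerTail` (crux stmt-CriticalPhenomena-4575), P2 — T₁ WITH A CUBE CO-SHARED BLOCK OF ANY DIMENSION ⟸ THE BOX INEQUALITIES
# (conjecture FCQ): the orbit regrouping of the pair decomposition

Seat `prim-masterthm-p2`, gen 32 (memo `FROM-prim-masterthm-p2-g32-BOX-FLOWS-AND-STAR.md` §0, SAHI-ROUTE.md §4.59;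
`--supports stmt-CriticalPhenomena-4575`).  No `sorry`, no named facts, standard axioms.

SETTING as in `…SahiHubCorner` / `…SahiHubCornerChain` (gens 30–31): hub coin `z ∈ Fin 2`, co-shared block `γ` of the first two
members, private FKG blocks `α, β`, the triple `f(z,c,a), g(z,c,b), h(z,a,b)`, hub-corner forms `q₀, q₁`, and the PAIR DECOMPOSITION
`2·q₁ = Σ_x Σ_y wC(x) wC(y)·CF(x,y)` (`two_mul_cornerQ1_eq_sum_pairForm`) with `CF = pairForm` the bias-free cross form of the two-point
family.  HERE the co-shared block is a CUBE: `γ = Finset κ` (the Boolean lattice of a finite type `κ`, i.e. `|κ|` co-shared coins) with a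
LOG-MODULAR probability weight `W` (`W(x)W(y) = W(x∩y)W(x∪y)`, every product Bernoulli weight), of ANY dimension.
* `boxSum a D = Σ_{u ⊆ D} CF(a ∪ u, a ∪ (D∖u))` — the (ordered) ANTIPODAL BOX SUM of the pair form over the box `[a, a ∪ D]`
  (each unordered antipodal pair counted twice; for `|D| = 2`, `D = {i,j}`, it is `2·[CF(a, a∪D) + CF(a∪{i}, a∪{j})]`, the `hbox` of
  `…SahiHubCornerChainSquare` up to translation).  On a cube `CF(x,y)` depends on the sections at `x, y` only, not on `W`: the box sums
  are the tensor-Bernstein coefficients of `q₁` in the coin biases (memo gen 31 §2).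
* `two_mul_cornerQ1_eq_sum_boxes` — **ORBIT REGROUPING** (pure bookkeeping + log-modularity, the mechanism of SAHI-ROUTE §4.33 /
  `…SahiCubePhi`): `2·q₁ = Σ_{(a,b)} W(a)W(b)·[a ⊆ b]·boxSum a (b∖a)` — the pairs `(x,y)` are grouped along the fibres of
  `(x,y) ↦ (x∩y, x∪y)`, each fibre being a box traversed antipodally (`SahiBox.fiber_eq_image`), on which `W(x)W(y)` is constant.
* `boxSum_nonneg_of_card_le_one` — boxes of dimension `0` and `1` are nonnegative for monotone nonnegative sections on FKG blocks:
  they consist of comparable pairs (`pairForm_nonneg_of_le` = gen 29's `I3 ≥ 0`).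
* **`cornerQ1_nonneg_cube_of_boxes`, `cornerQ0_nonneg_cube_of_boxes`, `sahiE_three_nonneg_T1_cube_of_boxes` (THE REDUCTION, every
  dimension):** if every box of dimension `≥ 2` inside `Finset κ` has `boxSum ≥ 0` for the given sections (conjecture FCQ of the memo,
  census-clean: kit j245242/j246156, 3.2·10¹⁰ exhaustive cells, 0 negative), then `q₁ ≥ 0`, `q₀ ≥ 0`, and Sahi's `E₃(f,g,h) ≥ 0` —
  Kahn's `C₃` — for `f(z,c,a), g(z,c,b), h(z,a,b)` with `c` ranging over the cube `Finset κ` with ANY log-modular probability weight and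
  any hub bias.  For `|κ| ≤ 1` the hypothesis is void (T₁(|C|≤1), gens 29/31); `|κ| = 2` recovers `…ChainSquare`.
HONEST LABEL: reduction (bookkeeping) — the box inequalities of dimension ≥ 2 remain OPEN; T₁ with ≥ 2 co-shared coins and Kahn's `C₃` OPEN.
The companion analysis of the box form (exact fibre characterisation by flows; the all-`m` STAR criterion) is in the memo. [this work]
-/

noncomputable section

open scoped Classical

namespace Summit.CriticalPhenomena.PercolationContinuityZ3.Theorems

namespace SahiHubCornerChain

open Finset Literature.Combinatorics.Sahi2008 SahiHubCorner SahiHubTwoLevel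

section Defs

variable {κ α β : Type} [Fintype κ] [Fintype α] [Fintype β]
  (wA : α → ℝ) (wB : β → ℝ) (f : Fin 2 → Finset κ → α → ℝ) (g : Fin 2 → Finset κ → β → ℝ) (h : Fin 2 → α → β → ℝ)

/-- **The antipodal BOX SUM** of the pair form over the box `[a, a ∪ D]` of the cube `Finset κ` (ordered pairs: each unordered
antipodal pair `{a ∪ u, a ∪ (D∖u)}` is counted twice): `boxSum a D = Σ_{u ⊆ D} CF(a ∪ u, a ∪ (D ∖ u))`. [this work] -/
def boxSum (a D : Finset κ) : ℝ :=
  ∑ u ∈ D.powerset, pairForm wA wB f g h (a ∪ u) (a ∪ (D \ u))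

end Defs

section Regroup

variable {κ α β : Type} [Fintype κ] [Fintype α] [Fintype β]
  {wA : α → ℝ} {wB : β → ℝ} {wC : Finset κ → ℝ}
  {f : Fin 2 → Finset κ → α → ℝ} {g : Fin 2 → Finset κ → β → ℝ} {h : Fin 2 → α → β → ℝ}

/-- The sum of the pair form over the fibre of `(x,y) ↦ (x ∩ y, x ∪ y)` above `(a,b)`, `a ⊆ b`, is the box sum over `[a,b]`. [this work] -/
theorem sum_fiber_pairForm (a b : Finset κ) (hab : a ⊆ b) :
    ∑ p ∈ (Finset.univ : Finset (Finset κ × Finset κ)).filter (fun p => p.1 ∩ p.2 = a ∧ p.1 ∪ p.2 = b),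
      pairForm wA wB f g h p.1 p.2 = boxSum wA wB f g h a (b \ a) := by
  rw [SahiBox.fiber_eq_image a b hab, Finset.sum_image]
  · rfl
  · intro u hu u' hu' huu
    have hu : u ⊆ b \ a := Finset.mem_powerset.1 hu
    have hu' : u' ⊆ b \ a := Finset.mem_powerset.1 hu'
    have h1 : a ∪ u = a ∪ u' := (Prod.mk.injEq _ _ _ _ ▸ huu).1
    have hd : Disjoint a u := Finset.disjoint_left.2 fun i hia hiu => (Finset.mem_sdiff.1 (hu hiu)).2 hia
    have hd' : Disjoint a u' := Finset.disjoint_left.2 fun i hia hiu => (Finset.mem_sdiff.1 (hu' hiu)).2 hia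
    calc u = (a ∪ u) \ a := (Finset.union_sdiff_cancel_left hd).symm
      _ = (a ∪ u') \ a := by rw [h1]
      _ = u' := Finset.union_sdiff_cancel_left hd'

/-- The fibre above `(a,b)` is empty unless `a ⊆ b`. [this work] -/
theorem fiber_eq_empty (a b : Finset κ) (hab : ¬ a ⊆ b) :
    ((Finset.univ : Finset (Finset κ × Finset κ)).filter fun p => p.1 ∩ p.2 = a ∧ p.1 ∪ p.2 = b) = ∅ := by
  refine Finset.filter_eq_empty_iff.2 fun p _ hp => hab ?_
  rw [← hp.1, ← hp.2]
  exact Finset.inter_subset_left.trans Finset.subset_union_left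

/-- **ORBIT REGROUPING.**  For a log-modular weight `W` on the cube and private weights of mass one,
`2·q₁ = Σ_{(a,b)} W(a)W(b)·(if a ⊆ b then boxSum a (b∖a) else 0)`. [this work] -/
theorem two_mul_cornerQ1_eq_sum_boxes (hA1 : ∑ a, wA a = 1) (hB1 : ∑ b, wB b = 1) (hW1 : ∑ c, wC c = 1)
    (hWmod : ∀ x y, wC x * wC y = wC (x ∩ y) * wC (x ∪ y)) :
    2 * cornerQ1 wA wB wC f g h =
      ∑ q : Finset κ × Finset κ, wC q.1 * wC q.2 * (if q.1 ⊆ q.2 then boxSum wA wB f g h q.1 (q.2 \ q.1) else 0) := by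
  rw [two_mul_cornerQ1_eq_sum_pairForm (wC := wC) (f := f) (g := g) (h := h) hA1 hB1 hW1, ← Finset.sum_product',
    Finset.univ_product_univ]
  rw [← Finset.sum_fiberwise_of_maps_to (s := (Finset.univ : Finset (Finset κ × Finset κ))) (t := Finset.univ)
    (g := fun p : Finset κ × Finset κ => (p.1 ∩ p.2, p.1 ∪ p.2)) (fun p _ => Finset.mem_univ _)]
  refine Finset.sum_congr rfl fun q _ => ?_
  have hconst : ∀ p ∈ (Finset.univ : Finset (Finset κ × Finset κ)).filter (fun p => (p.1 ∩ p.2, p.1 ∪ p.2) = q),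
      wC p.1 * wC p.2 * pairForm wA wB f g h p.1 p.2 = wC q.1 * wC q.2 * pairForm wA wB f g h p.1 p.2 := by
    intro p hp
    have hq := (Finset.mem_filter.1 hp).2
    rw [hWmod p.1 p.2, ← hq]
  rw [Finset.sum_congr rfl hconst, ← Finset.mul_sum]
  have hfilt : ((Finset.univ : Finset (Finset κ × Finset κ)).filter fun p => (p.1 ∩ p.2, p.1 ∪ p.2) = q) =
      (Finset.univ : Finset (Finset κ × Finset κ)).filter fun p => p.1 ∩ p.2 = q.1 ∧ p.1 ∪ p.2 = q.2 := by
    ext p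
    simp only [Finset.mem_filter, Finset.mem_univ, true_and, Prod.ext_iff]
  rw [hfilt]
  by_cases hab : q.1 ⊆ q.2
  · rw [if_pos hab, sum_fiber_pairForm q.1 q.2 hab]
  · rw [if_neg hab, fiber_eq_empty q.1 q.2 hab, Finset.sum_empty]

end Regroup

section Positivity

variable {κ α β : Type} [Fintype κ] [Fintype α] [Fintype β]
  {wA : α → ℝ} {wB : β → ℝ} {wC : Finset κ → ℝ}
  {f : Fin 2 → Finset κ → α → ℝ} {g : Fin 2 → Finset κ → β → ℝ} {h : Fin 2 → α → β → ℝ}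

omit [Fintype κ] in
/-- **Boxes of dimension `0` and `1` are nonnegative** (their antipodal pairs are comparable: `pairForm_nonneg_of_le`, gen 29's
`I3 ≥ 0`). [this work] -/
theorem boxSum_nonneg_of_card_le_one [DistribLattice α] [DistribLattice β]
    (hA : IsFKGMeasure wA) (hB : IsFKGMeasure wB)
    (hf0 : ∀ z c a, 0 ≤ f z c a) (hfa : ∀ z c, Monotone (f z c)) (hfc : ∀ z a, Monotone (fun c => f z c a))
    (hfz : ∀ c a, f 0 c a ≤ f 1 c a)
    (hg0 : ∀ z c b, 0 ≤ g z c b) (hgb : ∀ z c, Monotone (g z c)) (hgc : ∀ z b, Monotone (fun c => g z c b))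
    (hgz : ∀ c b, g 0 c b ≤ g 1 c b)
    (hh0 : ∀ z a b, 0 ≤ h z a b) (hha : ∀ z b, Monotone (fun a => h z a b)) (hhb : ∀ z a, Monotone (h z a))
    (hhz : ∀ a b, h 0 a b ≤ h 1 a b)
    (a D : Finset κ) (hD : D.card ≤ 1) : 0 ≤ boxSum wA wB f g h a D := by
  unfold boxSum
  refine Finset.sum_nonneg fun u hu => ?_
  have huD : u ⊆ D := Finset.mem_powerset.1 hu
  -- in a box of dimension ≤ 1 every antipodal pair is comparable
  have hcomp : u ⊆ D \ u ∨ D \ u ⊆ u := by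
    rcases Nat.lt_or_ge D.card 1 with h0 | h1
    · have hDe : D = ∅ := Finset.card_eq_zero.1 (by omega)
      left
      rw [hDe] at huD
      rw [Finset.subset_empty.1 huD]
      exact Finset.empty_subset _
    · obtain ⟨i, hi⟩ := Finset.card_eq_one.1 (le_antisymm hD h1)
      rw [hi] at huD ⊢
      rcases Finset.subset_singleton_iff.1 huD with hue | hue
      · left; rw [hue]; exact Finset.empty_subset _
      · right; rw [hue, Finset.sdiff_self]; exact Finset.empty_subset _
  rcases hcomp with hle | hle
  · exact pairForm_nonneg_of_le hA hB (Finset.union_subset_union (le_refl a) hle) hf0 hfa hfc hfz hg0 hgb hgc hgz hh0 hha hhb hhz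
  · rw [pairForm_symm]
    exact pairForm_nonneg_of_le hA hB (Finset.union_subset_union (le_refl a) hle) hf0 hfa hfc hfz hg0 hgb hgc hgz hh0 hha hhb hhz

/-- **`q₁ ≥ 0` ON A CUBE BLOCK OF ANY DIMENSION ⟸ THE BOX INEQUALITIES OF DIMENSION ≥ 2** (FCQ).  `W` a log-modular probability
weight on `Finset κ`, `α, β` FKG, sections nonnegative and monotone in every argument. [this work] -/
theorem cornerQ1_nonneg_cube_of_boxes [DistribLattice α] [DistribLattice β]
    (hA : IsFKGMeasure wA) (hB : IsFKGMeasure wB) (hW0 : ∀ c, 0 ≤ wC c) (hW1 : ∑ c, wC c = 1)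
    (hWmod : ∀ x y, wC x * wC y = wC (x ∩ y) * wC (x ∪ y))
    (hf0 : ∀ z c a, 0 ≤ f z c a) (hfa : ∀ z c, Monotone (f z c)) (hfc : ∀ z a, Monotone (fun c => f z c a))
    (hfz : ∀ c a, f 0 c a ≤ f 1 c a)
    (hg0 : ∀ z c b, 0 ≤ g z c b) (hgb : ∀ z c, Monotone (g z c)) (hgc : ∀ z b, Monotone (fun c => g z c b))
    (hgz : ∀ c b, g 0 c b ≤ g 1 c b)
    (hh0 : ∀ z a b, 0 ≤ h z a b) (hha : ∀ z b, Monotone (fun a => h z a b)) (hhb : ∀ z a, Monotone (h z a))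
    (hhz : ∀ a b, h 0 a b ≤ h 1 a b)
    (hbox : ∀ a D : Finset κ, Disjoint a D → 2 ≤ D.card → 0 ≤ boxSum wA wB f g h a D) :
    0 ≤ cornerQ1 wA wB wC f g h := by
  have h2 := two_mul_cornerQ1_eq_sum_boxes (f := f) (g := g) (h := h) hA.sum_eq_one hB.sum_eq_one hW1 hWmod
  have hs : 0 ≤ ∑ q : Finset κ × Finset κ,
      wC q.1 * wC q.2 * (if q.1 ⊆ q.2 then boxSum wA wB f g h q.1 (q.2 \ q.1) else 0) := by
    refine Finset.sum_nonneg fun q _ => mul_nonneg (mul_nonneg (hW0 _) (hW0 _)) ?_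
    split_ifs with hab
    · by_cases hcard : (q.2 \ q.1).card ≤ 1
      · exact boxSum_nonneg_of_card_le_one hA hB hf0 hfa hfc hfz hg0 hgb hgc hgz hh0 hha hhb hhz q.1 _ hcard
      · exact hbox q.1 (q.2 \ q.1) Finset.disjoint_sdiff (by omega)
    · exact le_refl _
  linarith

/-- **`q₀ ≥ 0` on a cube block of any dimension ⟸ the box inequalities of dimension ≥ 2** (`q₀ = q₁ + Δf·Δg·Δh`). [this work] -/
theorem cornerQ0_nonneg_cube_of_boxes [DistribLattice α] [DistribLattice β]
    (hA : IsFKGMeasure wA) (hB : IsFKGMeasure wB) (hW0 : ∀ c, 0 ≤ wC c) (hW1 : ∑ c, wC c = 1)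
    (hWmod : ∀ x y, wC x * wC y = wC (x ∩ y) * wC (x ∪ y))
    (hf0 : ∀ z c a, 0 ≤ f z c a) (hfa : ∀ z c, Monotone (f z c)) (hfc : ∀ z a, Monotone (fun c => f z c a))
    (hfz : ∀ c a, f 0 c a ≤ f 1 c a)
    (hg0 : ∀ z c b, 0 ≤ g z c b) (hgb : ∀ z c, Monotone (g z c)) (hgc : ∀ z b, Monotone (fun c => g z c b))
    (hgz : ∀ c b, g 0 c b ≤ g 1 c b)
    (hh0 : ∀ z a b, 0 ≤ h z a b) (hha : ∀ z b, Monotone (fun a => h z a b)) (hhb : ∀ z a, Monotone (h z a))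
    (hhz : ∀ a b, h 0 a b ≤ h 1 a b)
    (hbox : ∀ a D : Finset κ, Disjoint a D → 2 ≤ D.card → 0 ≤ boxSum wA wB f g h a D) :
    0 ≤ cornerQ0 wA wB wC f g h := by
  rw [cornerQ0_eq]
  have h1 := cornerQ1_nonneg_cube_of_boxes hA hB hW0 hW1 hWmod hf0 hfa hfc hfz hg0 hgb hgc hgz hh0 hha hhb hhz hbox
  have hF := exL_F1_sub_nonneg (f := f) (wC := wC) hA.nonneg hB.sum_eq_one hW0 hfz
  have hG := exL_F2_sub_nonneg (g := g) (wC := wC) hA.sum_eq_one hB.nonneg hW0 hgz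
  have hH := exL_F3_sub_nonneg (h := h) (wC := wC) hA.nonneg hB.nonneg hW1 hhz
  have := mul_nonneg (mul_nonneg hF hG) hH
  linarith

omit [Fintype α] [Fintype β] in
/-- A log-modular probability weight on the cube `Finset κ` is an FKG measure. [folklore] -/
theorem isFKGMeasure_of_logModular (hW0 : ∀ c, 0 ≤ wC c) (hW1 : ∑ c, wC c = 1)
    (hWmod : ∀ x y, wC x * wC y = wC (x ∩ y) * wC (x ∪ y)) : IsFKGMeasure wC :=
  { nonneg := hW0
    sum_eq_one := hW1
    mul_le_mul := fun a b => by rw [Finset.inf_eq_inter, Finset.sup_eq_union, hWmod a b] }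

/-- **THEOREM (T₁ WITH A CUBE CO-SHARED BLOCK OF ANY DIMENSION ⟸ FCQ).**  Hub coin `z` (weight `wZ ≥ 0`, `wZ 0 + wZ 1 = 1`),
co-shared block the cube `Finset κ` with a log-modular probability weight `W` (any product Bernoulli weight: `|κ|` co-shared coins with
arbitrary biases), private FKG blocks `α, β`; `f(z,c,a), g(z,c,b), h(z,a,b)` nonnegative and monotone in every argument.  If every box
`[a, a ∪ D] ⊆ Finset κ` of dimension `|D| ≥ 2` has a nonnegative antipodal box sum of the pair form for these sections, then Sahi's
`E₃(f,g,h) ≥ 0` (Kahn's `C₃`).  Dimensions `0, 1` are theorems (`boxSum_nonneg_of_card_le_one`); so for `|κ| ≤ 1` the hypothesis is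
empty and for `|κ| = 2` it is the single inequality `hbox` of `…SahiHubCornerChainSquare`. [this work] -/
theorem sahiE_three_nonneg_T1_cube_of_boxes [DistribLattice α] [DistribLattice β] {wZ : Fin 2 → ℝ}
    (hA : IsFKGMeasure wA) (hB : IsFKGMeasure wB) (hW0 : ∀ c, 0 ≤ wC c) (hW1 : ∑ c, wC c = 1)
    (hWmod : ∀ x y, wC x * wC y = wC (x ∩ y) * wC (x ∪ y))
    (hZ0 : 0 ≤ wZ 0) (hZ1 : 0 ≤ wZ 1) (hZ : wZ 0 + wZ 1 = 1)
    (hf0 : ∀ z c a, 0 ≤ f z c a) (hfa : ∀ z c, Monotone (f z c)) (hfc : ∀ z a, Monotone (fun c => f z c a))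
    (hfz : ∀ c a, f 0 c a ≤ f 1 c a)
    (hg0 : ∀ z c b, 0 ≤ g z c b) (hgb : ∀ z c, Monotone (g z c)) (hgc : ∀ z b, Monotone (fun c => g z c b))
    (hgz : ∀ c b, g 0 c b ≤ g 1 c b)
    (hh0 : ∀ z a b, 0 ≤ h z a b) (hha : ∀ z b, Monotone (fun a => h z a b)) (hhb : ∀ z a, Monotone (h z a))
    (hhz : ∀ a b, h 0 a b ≤ h 1 a b)
    (hbox : ∀ a D : Finset κ, Disjoint a D → 2 ≤ D.card → 0 ≤ boxSum wA wB f g h a D) :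
    0 ≤ sahiE (W wA wB wC wZ) 3 ![F1 f, F2 g, F3 h] :=
  sahiE_three_nonneg_T1_of_corner hA hB (isFKGMeasure_of_logModular hW0 hW1 hWmod) hZ0 hZ1 hZ
    hf0 hfa hfc hg0 hgb hgc hh0 hha hhb
    (cornerQ0_nonneg_cube_of_boxes hA hB hW0 hW1 hWmod hf0 hfa hfc hfz hg0 hgb hgc hgz hh0 hha hhb hhz hbox)
    (cornerQ1_nonneg_cube_of_boxes hA hB hW0 hW1 hWmod hf0 hfa hfc hfz hg0 hgb hgc hgz hh0 hha hhb hhz hbox)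

end Positivity

end SahiHubCornerChain

end Summit.CriticalPhenomena.PercolationContinuityZ3.Theorems
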